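import Literature.Analysis.FunctionSpaces.PolchinskiContinuityAssumption
import Mathlib.Probability.Distributions.Gaussian.Fernique
import Mathlib.Analysis.Calculus.ContDiff.Bounds
import Mathlib.Analysis.SpecialFunctions.Log.Deriv
import Mathlib.Analysis.Complex.Exponential
import Mathlib.Analysis.InnerProductSpace.Calculus
import HarnessLib

/-!
# Gaussian smoothing of a bounded measurable function is `C^∞` with bounded derivatives;
# the renormalised potential `V_s` is `C_b^∞` for `C_s ≻ 0` (Bauerschmidt–Bodineau–Dagallier, Def 2)

Topic `Literature/Analysis/FunctionSpaces`; companion of `MultiscaleBakryEmery.lean` and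
`PolchinskiContinuityAssumption.lean`.

For a nondegenerate covariance `S ≻ 0` and a bounded measurable `k : ℝ^N → ℝ`, the Gaussian average
`Z(φ) = E_S[k(φ + ζ)]` is `C^∞` and every derivative is bounded uniformly in `φ`.  Proof: by the
Cameron–Martin formula (Janson 1997, Thm 14.1 (14.9); tree `integral_stdGaussian_comp_add`)
`E_γ[k(y + x)] = E_γ[e^{⟨x,y⟩ − ‖y‖²/2} k(x)]`, so the `y`-dependence sits in the smooth tilt
`y ↦ e^{⟨x,y⟩ − ‖y‖²/2}`, whose `n`-th derivative is bounded by `n! e^{‖x‖‖y‖}(‖x‖ + ‖y‖ + 1)^n` (Faà di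
Bruno bound `norm_iteratedFDeriv_comp_le`); differentiation under the Gaussian integral (dominated via
Fernique's theorem) gives the full Taylor series, and translation invariance gives bounds uniform in `y`
(`‖Dⁿ‖ ≤ ‖k‖_∞ · n! · E_γ[(‖x‖+1)^n]`).  Consequently, for `V₀` measurable and BOUNDED and `C_s ≻ 0`,
the renormalised potential `V_s = −log E_{C_s}[e^{−V₀(·+ζ)}]` of [BBD] Def 2 is `C^∞` with all
derivatives bounded — the regularity class `C_b⁴` required by the tree's proof of [BBD] Theorem 3
(`Polchinski.entropy_le_of_multiscaleBakryEmery`, `…logSobolev_of_multiscaleBakryEmery_of_contDiff_one`)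
is produced by the flow itself after any positive time (Janson 1997, Theorem 14.1 (vi): the
Cameron–Martin shift is smoothing).  This is the input of the restart argument extending the proved
Theorem 3 to bounded measurable `V₀`.

## Main results (sorry-free; no new definitions, no new named facts)

* `contDiff_integral_stdGaussian_comp_add`, `norm_iteratedFDeriv_integral_stdGaussian_comp_add_le` —
  `y ↦ E_γ[k(y + ·)]` is `C^∞` with `‖Dⁿ‖ ≤ ‖k‖_∞ n! E_γ[(‖x‖+1)^n]`.
* `contDiff_integral_multivariateGaussian_comp_add` — the same for `N(0,S)`, `S ≻ 0`, with uniform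
  bounds.
* `contDiff_renormPotential_of_posDef`, `exists_bound_iteratedFDeriv_renormPotential_of_posDef` —
  `V_s ∈ C_b^∞` for bounded measurable `V₀` and `C_s ≻ 0`.

No claim about Yang–Mills is made (the Clay problem is untouched; in this programme the criterion bears
only on the conditional rung `BalabanLadder.UV`).

## References

* [BauerschmidtBodineauDagallier2023] R. Bauerschmidt, T. Bodineau, B. Dagallier, Probab. Surveys 21
  (2024) 200–290 — Def 2 p0013 (renormalised potential), §3.1 (Gaussian convolution). READ (held text).
* [Janson1997] S. Janson, *Gaussian Hilbert Spaces*, CUP 1997 — Theorem 14.1 (14.9), (vi): the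
  Cameron–Martin shift and its smoothing property (PDF p0244–0245). READ (held).
-/

noncomputable section

open MeasureTheory ProbabilityTheory Filter Topology Set
open scoped RealInnerProductSpace Matrix MatrixOrder ContDiff

namespace Literature.Analysis.FunctionSpaces

namespace Polchinski

/-! ### 1. The Gaussian tilt `y ↦ e^{⟨x,y⟩ − ‖y‖²/2}`: smoothness and derivative bounds -/

section Tilt

variable {E : Type*} [NormedAddCommGroup E] [InnerProductSpace ℝ E]

/-- The exponent `y ↦ ⟨x,y⟩ − ‖y‖²/2` is smooth. [folklore] -/
private theorem contDiff_exponent (x : E) :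
    ContDiff ℝ ∞ fun y : E => ⟪x, y⟫ - ‖y‖ ^ 2 / 2 :=
  (contDiff_const.inner ℝ contDiff_id).sub ((contDiff_norm_sq ℝ).div_const _)

/-- The tilt `y ↦ e^{⟨x,y⟩ − ‖y‖²/2}` (Janson's Wick exponential `:e^{⟨x,·⟩}:` composed with the shift) is
smooth. [cite: Janson1997, Theorem 14.1] -/
theorem contDiff_tilt (x : E) :
    ContDiff ℝ ∞ fun y : E => Real.exp (⟪x, y⟫ - ‖y‖ ^ 2 / 2) :=
  Real.contDiff_exp.comp (contDiff_exponent x)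

/-- All iterated derivatives of `Real.exp` have norm `e^t`. [folklore] -/
private theorem norm_iteratedFDeriv_exp (i : ℕ) (t : ℝ) :
    ‖iteratedFDeriv ℝ i Real.exp t‖ = Real.exp t := by
  rw [norm_iteratedFDeriv_eq_norm_iteratedDeriv, iteratedDeriv_eq_iterate, Real.iter_deriv_exp,
    Real.norm_eq_abs, abs_of_pos (Real.exp_pos _)]

/-- The inner product as a real-bilinear continuous map `E →L[ℝ] E →L[ℝ] ℝ` has norm `≤ 1`. [folklore] -/
private theorem norm_innerSL_real_le_one : ‖(innerSL ℝ : E →L[ℝ] E →L[ℝ] ℝ)‖ ≤ 1 :=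
  ContinuousLinearMap.opNorm_le_bound _ zero_le_one fun v => by
    rw [one_mul]
    exact (innerSL_apply_norm ℝ v).le

/-- The first derivative of the exponent: `D(⟨x,·⟩ − ‖·‖²/2)(y) = ⟨x − y, ·⟩`. [folklore] -/
private theorem fderiv_exponent (x : E) :
    fderiv ℝ (fun y : E => ⟪x, y⟫ - ‖y‖ ^ 2 / 2) = fun y => innerSL ℝ (x - y) := by
  funext y
  have h1 : HasFDerivAt (fun y : E => ⟪x, y⟫) (innerSL ℝ x) y := (innerSL ℝ x).hasFDerivAt
  have h2 : HasFDerivAt (fun y : E => ‖y‖ ^ 2 / 2) (innerSL ℝ y) y := by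
    have h : HasFDerivAt (fun y : E => (2⁻¹ : ℝ) * ‖y‖ ^ 2) ((2⁻¹ : ℝ) • (2 • innerSL ℝ y)) y :=
      (hasStrictFDerivAt_norm_sq y).hasFDerivAt.const_mul (2⁻¹ : ℝ)
    have e1 : (fun y : E => (2⁻¹ : ℝ) * ‖y‖ ^ 2) = fun y => ‖y‖ ^ 2 / 2 := by
      funext y; ring
    have e2 : (2⁻¹ : ℝ) • (2 • innerSL ℝ y) = innerSL ℝ y := by
      ext v
      simp only [FunLike.coe_smul, Pi.smul_apply, smul_eq_mul, two_smul,
        _root_.add_apply]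
      ring
    rw [e1] at h
    exact h.congr_fderiv e2
  have h3 : HasFDerivAt (fun y : E => ⟪x, y⟫ - ‖y‖ ^ 2 / 2) (innerSL ℝ x - innerSL ℝ y) y :=
    h1.sub h2
  rw [h3.fderiv, map_sub]

/-- The second derivative of the exponent is the constant `−⟨·,·⟩`. [folklore] -/
private theorem fderiv_fderiv_exponent (x : E) :
    fderiv ℝ (fderiv ℝ (fun y : E => ⟪x, y⟫ - ‖y‖ ^ 2 / 2)) =
      fun _ => -(innerSL ℝ : E →L[ℝ] E →L[ℝ] ℝ) := by
  rw [fderiv_exponent]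
  funext y
  have h : HasFDerivAt (fun y : E => (innerSL ℝ : E →L[ℝ] E →L[ℝ] ℝ) (x - y))
      ((innerSL ℝ : E →L[ℝ] E →L[ℝ] ℝ).comp (0 - ContinuousLinearMap.id ℝ E)) y :=
    (innerSL ℝ : E →L[ℝ] E →L[ℝ] ℝ).hasFDerivAt.comp y
      ((hasFDerivAt_const x y).sub (hasFDerivAt_id y))
  rw [h.fderiv]
  ext v w
  simp

/-- Derivative bounds of the exponent: `‖Dⁱ(⟨x,·⟩ − ‖·‖²/2)(y)‖ ≤ (‖x‖ + ‖y‖ + 1)^i` for `i ≥ 1`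
(`D¹ = ⟨x − y, ·⟩`, `D² = −⟨·,·⟩`, `D^{≥3} = 0`). [folklore] -/
private theorem norm_iteratedFDeriv_exponent_le (x y : E) {i : ℕ} (hi : 1 ≤ i) :
    ‖iteratedFDeriv ℝ i (fun y : E => ⟪x, y⟫ - ‖y‖ ^ 2 / 2) y‖ ≤ (‖x‖ + ‖y‖ + 1) ^ i := by
  have hD1 : 1 ≤ ‖x‖ + ‖y‖ + 1 := by linarith [norm_nonneg x, norm_nonneg y]
  rcases Nat.exists_eq_add_of_le hi with ⟨j, rfl⟩
  rcases j with _ | j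
  · -- `i = 1`
    rw [show (1 + 0 : ℕ) = 1 from rfl, pow_one, norm_iteratedFDeriv_one, fderiv_exponent,
      innerSL_apply_norm]
    exact (norm_sub_le _ _).trans (by linarith)
  rcases j with _ | j
  · -- `i = 2`
    rw [show (1 + (0 + 1) : ℕ) = 1 + 1 from rfl, ← norm_iteratedFDeriv_fderiv, norm_iteratedFDeriv_one,
      fderiv_fderiv_exponent, norm_neg]
    exact norm_innerSL_real_le_one.trans (one_le_pow₀ hD1)
  · -- `i ≥ 3`
    rw [show (1 + (j + 1 + 1) : ℕ) = (j + 1) + 1 + 1 by ring, ← norm_iteratedFDeriv_fderiv,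
      ← norm_iteratedFDeriv_fderiv, fderiv_fderiv_exponent,
      iteratedFDeriv_const_of_ne (by omega : j + 1 ≠ 0), Pi.zero_apply, norm_zero]
    positivity

/-- **Derivative bound for the Gaussian tilt**: for every `n`,
`‖Dⁿ_y e^{⟨x,y⟩ − ‖y‖²/2}‖ ≤ n! · e^{‖x‖‖y‖} · (‖x‖ + ‖y‖ + 1)ⁿ` (Faà di Bruno bound for `exp ∘ quadratic`).
[cite: Janson1997, Theorem 14.1] -/
theorem norm_iteratedFDeriv_tilt_le (x y : E) (n : ℕ) :
    ‖iteratedFDeriv ℝ n (fun y : E => Real.exp (⟪x, y⟫ - ‖y‖ ^ 2 / 2)) y‖ ≤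
      (n.factorial : ℝ) * Real.exp (‖x‖ * ‖y‖) * (‖x‖ + ‖y‖ + 1) ^ n := by
  have hcomp : (fun y : E => Real.exp (⟪x, y⟫ - ‖y‖ ^ 2 / 2)) =
      Real.exp ∘ fun y : E => ⟪x, y⟫ - ‖y‖ ^ 2 / 2 := rfl
  rw [hcomp]
  refine norm_iteratedFDeriv_comp_le (N := ∞) Real.contDiff_exp (contDiff_exponent x)
    (by exact_mod_cast le_top) y (fun i _ => ?_) (fun i hi _ => norm_iteratedFDeriv_exponent_le x y hi)
  rw [norm_iteratedFDeriv_exp]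
  refine Real.exp_le_exp.2 ?_
  have h := real_inner_le_norm x y
  nlinarith [sq_nonneg ‖y‖]

/-- At the base point the bound is `n! (‖x‖+1)ⁿ`. [cite: Janson1997, Theorem 14.1] -/
theorem norm_iteratedFDeriv_tilt_zero_le (x : E) (n : ℕ) :
    ‖iteratedFDeriv ℝ n (fun y : E => Real.exp (⟪x, y⟫ - ‖y‖ ^ 2 / 2)) 0‖ ≤ (n.factorial : ℝ) * (‖x‖ + 1) ^ n := by
  have h := norm_iteratedFDeriv_tilt_le x 0 n
  simpa using h

end Tilt

/-! ### 2. Gaussian integrability of exponential-polynomial envelopes (Fernique) -/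

section Envelope

variable {E : Type*} [NormedAddCommGroup E] [InnerProductSpace ℝ E] [FiniteDimensional ℝ E]
  [MeasurableSpace E] [BorelSpace E]

/-- `x ↦ e^{a‖x‖}(‖x‖ + b)^m` is integrable for the standard Gaussian (from Fernique's theorem
`IsGaussian.exists_integrable_exp_sq`: `e^{C‖x‖²}` is integrable for some `C > 0`, and
`e^{a‖x‖}(‖x‖+b)^m ≤ m!·e^{b + (a+1)²/(4C)}·e^{C‖x‖²}`). [folklore] -/
private theorem integrable_exp_mul_norm_mul_pow (a : ℝ) {b : ℝ} (hb : 0 ≤ b) (m : ℕ) :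
    Integrable (fun x : E => Real.exp (a * ‖x‖) * (‖x‖ + b) ^ m) (stdGaussian E) := by
  obtain ⟨C, hC, hint⟩ := IsGaussian.exists_integrable_exp_sq (stdGaussian E)
  set M : ℝ := (m.factorial : ℝ) * Real.exp (b + (a + 1) ^ 2 / (4 * C)) with hM
  refine Integrable.mono' (hint.const_mul M) (by fun_prop) (Eventually.of_forall fun x => ?_)
  have hx : 0 ≤ ‖x‖ := norm_nonneg x
  rw [Real.norm_eq_abs, abs_of_nonneg (by positivity)]
  -- `(‖x‖ + b)^m ≤ m! e^{‖x‖ + b}`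
  have h1 : (‖x‖ + b) ^ m ≤ (m.factorial : ℝ) * Real.exp (‖x‖ + b) := by
    have h := Real.pow_div_factorial_le_exp (x := ‖x‖ + b) (by positivity) m
    rwa [div_le_iff₀ (by positivity), mul_comm] at h
  -- `(a + 1)‖x‖ ≤ C‖x‖² + (a+1)²/(4C)`
  have h2 : (a + 1) * ‖x‖ ≤ C * ‖x‖ ^ 2 + (a + 1) ^ 2 / (4 * C) := by
    have h : 0 ≤ C * (‖x‖ - (a + 1) / (2 * C)) ^ 2 := by positivity
    have e : C * (‖x‖ - (a + 1) / (2 * C)) ^ 2 =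
        C * ‖x‖ ^ 2 - (a + 1) * ‖x‖ + (a + 1) ^ 2 / (4 * C) := by
      field_simp
      ring
    linarith [e ▸ h]
  calc Real.exp (a * ‖x‖) * (‖x‖ + b) ^ m
      ≤ Real.exp (a * ‖x‖) * ((m.factorial : ℝ) * Real.exp (‖x‖ + b)) :=
        mul_le_mul_of_nonneg_left h1 (Real.exp_pos _).le
    _ = (m.factorial : ℝ) * Real.exp b * Real.exp ((a + 1) * ‖x‖) := by
        rw [show (a + 1) * ‖x‖ = a * ‖x‖ + ‖x‖ by ring, Real.exp_add, Real.exp_add]; ring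
    _ ≤ (m.factorial : ℝ) * Real.exp b * Real.exp (C * ‖x‖ ^ 2 + (a + 1) ^ 2 / (4 * C)) := by
        gcongr
    _ = M * Real.exp (C * ‖x‖ ^ 2) := by
        rw [hM, Real.exp_add, Real.exp_add]; ring

/-- The Gaussian moments `E_γ[(‖x‖ + 1)ⁿ]` are finite. [folklore] -/
private theorem integrable_norm_add_one_pow (n : ℕ) :
    Integrable (fun x : E => (‖x‖ + 1) ^ n) (stdGaussian E) := by
  have h := integrable_exp_mul_norm_mul_pow (E := E) 0 zero_le_one n
  simpa using h

end Envelope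

/-! ### 3. The Gaussian average `y ↦ E_γ[k(y + ·)]` of a bounded measurable `k` is `C^∞`
with uniformly bounded derivatives -/

section Smoothing

variable {E : Type*} [NormedAddCommGroup E] [InnerProductSpace ℝ E] [FiniteDimensional ℝ E]
  [MeasurableSpace E] [BorelSpace E]

omit [FiniteDimensional ℝ E] [MeasurableSpace E] [BorelSpace E] in
/-- Joint smoothness of the tilt `(x,y) ↦ e^{⟨x,y⟩ − ‖y‖²/2}`. [folklore] -/
private theorem contDiff_tilt_uncurry :
    ContDiff ℝ ∞ fun p : E × E => Real.exp (⟪p.1, p.2⟫ - ‖p.2‖ ^ 2 / 2) :=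
  Real.contDiff_exp.comp ((contDiff_fst.inner ℝ contDiff_snd).sub
    ((contDiff_snd.norm_sq ℝ).div_const _))

omit [FiniteDimensional ℝ E] [MeasurableSpace E] [BorelSpace E] in
/-- The iterated `y`-derivatives of the tilt depend continuously on the parameter `x`
(they are the full iterated derivatives of the jointly smooth `(x,y) ↦ e^{⟨x,y⟩ − ‖y‖²/2}` composed
with the inclusion `y ↦ (x,y)`). [folklore] -/
private theorem continuous_iteratedFDeriv_tilt (m : ℕ) (y : E) :
    Continuous fun x : E => iteratedFDeriv ℝ m (fun y : E => Real.exp (⟪x, y⟫ - ‖y‖ ^ 2 / 2)) y := by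
  set Ψ : E × E → ℝ := fun p => Real.exp (⟪p.1, p.2⟫ - ‖p.2‖ ^ 2 / 2) with hΨ
  have hΨs : ContDiff ℝ ∞ Ψ := contDiff_tilt_uncurry
  set J : E →L[ℝ] E × E := ContinuousLinearMap.inr ℝ E E with hJ
  have hm : (m : ℕ∞ω) ≤ ∞ := by exact_mod_cast le_top
  have key : ∀ x : E, iteratedFDeriv ℝ m (fun y : E => Real.exp (⟪x, y⟫ - ‖y‖ ^ 2 / 2)) y =
      (iteratedFDeriv ℝ m Ψ ((x, 0) + J y)).compContinuousLinearMap fun _ => J := by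
    intro x
    have hfun : (fun y : E => Real.exp (⟪x, y⟫ - ‖y‖ ^ 2 / 2)) =
        (fun z : E × E => Ψ ((x, 0) + z)) ∘ J := by
      funext y'
      simp [hΨ, hJ, Function.comp]
    have hsm : ContDiff ℝ ∞ fun z : E × E => Ψ ((x, 0) + z) :=
      hΨs.comp (contDiff_const.add contDiff_id)
    rw [hfun, J.iteratedFDeriv_comp_right hsm y hm, iteratedFDeriv_comp_add_left]
  simp_rw [key]
  exact (ContinuousMultilinearMap.continuous_precomp _).comp
    ((hΨs.continuous_iteratedFDeriv hm).comp
      ((continuous_id.prodMk continuous_const).add continuous_const))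

variable {k : E → ℝ} {K : ℝ}

/-- Integrability of the tilted integrands `x ↦ k(x)·Dᵐ_y e^{⟨x,y⟩−‖y‖²/2}`. [folklore] -/
private theorem integrable_smul_iteratedFDeriv_tilt (hk : Measurable k) (hK : ∀ z, |k z| ≤ K)
    (m : ℕ) (y : E) :
    Integrable (fun x : E => k x • iteratedFDeriv ℝ m
      (fun y : E => Real.exp (⟪x, y⟫ - ‖y‖ ^ 2 / 2)) y) (stdGaussian E) := by
  have hK0 : 0 ≤ K := (abs_nonneg _).trans (hK 0)
  refine Integrable.mono'
    ((integrable_exp_mul_norm_mul_pow (E := E) ‖y‖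
      (by positivity : (0 : ℝ) ≤ ‖y‖ + 1) m).const_mul (K * m.factorial))
    (hk.aestronglyMeasurable.smul (continuous_iteratedFDeriv_tilt m y).aestronglyMeasurable)
    (Eventually.of_forall fun x => ?_)
  rw [norm_smul, Real.norm_eq_abs]
  have h := norm_iteratedFDeriv_tilt_le x y m
  calc |k x| * ‖iteratedFDeriv ℝ m (fun y : E => Real.exp (⟪x, y⟫ - ‖y‖ ^ 2 / 2)) y‖
      ≤ K * ((m.factorial : ℝ) * Real.exp (‖x‖ * ‖y‖) * (‖x‖ + ‖y‖ + 1) ^ m) :=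
        mul_le_mul (hK x) h (norm_nonneg _) hK0
    _ = K * m.factorial * (Real.exp (‖y‖ * ‖x‖) * (‖x‖ + (‖y‖ + 1)) ^ m) := by
        rw [mul_comm ‖x‖ ‖y‖, add_assoc]; ring

/-- **The Taylor series of a Gaussian average.**  For a bounded measurable `k`, the function
`y ↦ E_γ[k(y + x)]` has the Taylor series `pₘ(y) = E_γ[k(x) · Dᵐ_y e^{⟨x,y⟩ − ‖y‖²/2}]` to all orders
(Cameron–Martin formula, Janson 1997 Thm 14.1 (14.9), differentiated under the integral sign; the
smoothing property (vi) of the Cameron–Martin shift). [cite: Janson1997, Theorem 14.1] -/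
theorem hasFTaylorSeriesUpTo_integral_stdGaussian_comp_add (hk : Measurable k) (hK : ∀ z, |k z| ≤ K) :
    HasFTaylorSeriesUpTo ∞ (fun y : E => ∫ x, k (y + x) ∂stdGaussian E)
      (fun y m => ∫ x, k x • iteratedFDeriv ℝ m
        (fun y : E => Real.exp (⟪x, y⟫ - ‖y‖ ^ 2 / 2)) y ∂stdGaussian E) := by
  have hK0 : 0 ≤ K := (abs_nonneg _).trans (hK 0)
  refine (hasFTaylorSeriesUpTo_top_iff' le_rfl).2 ⟨fun y => ?_, fun m y₀ => ?_⟩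
  · -- order zero: the Cameron–Martin formula
    have hint := integrable_smul_iteratedFDeriv_tilt hk hK 0 y
    show (∫ x, k x • iteratedFDeriv ℝ 0 (fun y : E => Real.exp (⟪x, y⟫ - ‖y‖ ^ 2 / 2)) y
      ∂stdGaussian E) 0 = ∫ x, k (y + x) ∂stdGaussian E
    rw [ContinuousMultilinearMap.integral_apply hint, integral_stdGaussian_comp_add k y]
    refine integral_congr_ae (Eventually.of_forall fun x => ?_)
    show (k x • iteratedFDeriv ℝ 0 (fun y : E => Real.exp (⟪x, y⟫ - ‖y‖ ^ 2 / 2)) y) 0 = _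
    rw [_root_.smul_apply, iteratedFDeriv_zero_apply, smul_eq_mul, mul_comm]
  · -- the derivative of `y ↦ pₘ(y)` is `p_{m+1}(y₀).curryLeft`: differentiate under the integral
    have hm : (m : ℕ∞ω) < ∞ := by exact_mod_cast ENat.coe_lt_top m
    set Lc := (continuousMultilinearCurryLeftEquiv ℝ (fun _ : Fin (m + 1) => E) ℝ) with hLc
    have hcurry : ∀ (c : ℝ) (M : ContinuousMultilinearMap ℝ (fun _ : Fin (m + 1) => E) ℝ),
        c • M.curryLeft = (c • M).curryLeft := fun c M => by
      show c • Lc M = Lc (c • M)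
      rw [map_smul]
    have h_diff : ∀ (x y : E), HasFDerivAt
        (fun y => k x • iteratedFDeriv ℝ m (fun y : E => Real.exp (⟪x, y⟫ - ‖y‖ ^ 2 / 2)) y)
        ((k x • iteratedFDeriv ℝ (m + 1) (fun y : E => Real.exp (⟪x, y⟫ - ‖y‖ ^ 2 / 2)) y).curryLeft)
        y := by
      intro x y
      have hT := (contDiff_iff_ftaylorSeries.1 (contDiff_tilt x)).fderiv m hm y
      exact (hT.const_smul (k x)).congr_fderiv (hcurry _ _)
    set bound : E → ℝ := fun x => K * ((m + 1).factorial : ℝ) *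
      (Real.exp ((‖y₀‖ + 1) * ‖x‖) * (‖x‖ + (‖y₀‖ + 2)) ^ (m + 1)) with hbound
    have hbi : Integrable bound (stdGaussian E) :=
      (integrable_exp_mul_norm_mul_pow (E := E) (‖y₀‖ + 1) (by positivity) (m + 1)).const_mul _
    have h_bound : ∀ (x : E), ∀ y ∈ Metric.ball y₀ (1 : ℝ),
        ‖(k x • iteratedFDeriv ℝ (m + 1) (fun y : E => Real.exp (⟪x, y⟫ - ‖y‖ ^ 2 / 2)) y).curryLeft‖
          ≤ bound x := by
      intro x y hy
      rw [ContinuousMultilinearMap.curryLeft_norm, norm_smul, Real.norm_eq_abs]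
      have hy' : ‖y‖ ≤ ‖y₀‖ + 1 := by
        have h1 : ‖y - y₀‖ < 1 := mem_ball_iff_norm.1 hy
        calc ‖y‖ = ‖(y - y₀) + y₀‖ := by rw [sub_add_cancel]
          _ ≤ ‖y - y₀‖ + ‖y₀‖ := norm_add_le _ _
          _ ≤ ‖y₀‖ + 1 := by linarith
      have h := norm_iteratedFDeriv_tilt_le x y (m + 1)
      have hx := norm_nonneg x
      have e1 : Real.exp (‖x‖ * ‖y‖) ≤ Real.exp ((‖y₀‖ + 1) * ‖x‖) :=
        Real.exp_le_exp.2 (by nlinarith)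
      have e2 : (‖x‖ + ‖y‖ + 1) ^ (m + 1) ≤ (‖x‖ + (‖y₀‖ + 2)) ^ (m + 1) :=
        pow_le_pow_left₀ (by positivity) (by linarith) _
      have e3 : ((m + 1).factorial : ℝ) * Real.exp (‖x‖ * ‖y‖) * (‖x‖ + ‖y‖ + 1) ^ (m + 1) ≤
          ((m + 1).factorial : ℝ) * Real.exp ((‖y₀‖ + 1) * ‖x‖) * (‖x‖ + (‖y₀‖ + 2)) ^ (m + 1) :=
        mul_le_mul (mul_le_mul_of_nonneg_left e1 (by positivity)) e2 (by positivity) (by positivity)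
      calc |k x| * ‖iteratedFDeriv ℝ (m + 1) (fun y : E => Real.exp (⟪x, y⟫ - ‖y‖ ^ 2 / 2)) y‖
          ≤ K * (((m + 1).factorial : ℝ) * Real.exp (‖x‖ * ‖y‖) * (‖x‖ + ‖y‖ + 1) ^ (m + 1)) :=
            mul_le_mul (hK x) h (norm_nonneg _) hK0
        _ ≤ K * (((m + 1).factorial : ℝ) * Real.exp ((‖y₀‖ + 1) * ‖x‖) *
              (‖x‖ + (‖y₀‖ + 2)) ^ (m + 1)) := mul_le_mul_of_nonneg_left e3 hK0
        _ = bound x := by simp only [hbound]; ring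
    have hF'm : AEStronglyMeasurable (fun x => (k x •
        iteratedFDeriv ℝ (m + 1) (fun y : E => Real.exp (⟪x, y⟫ - ‖y‖ ^ 2 / 2)) y₀).curryLeft)
        (stdGaussian E) := by
      have h := (integrable_smul_iteratedFDeriv_tilt hk hK (m + 1) y₀).aestronglyMeasurable
      exact Lc.continuous.comp_aestronglyMeasurable h
    have hmain := hasFDerivAt_integral_of_dominated_of_fderiv_le (Metric.ball_mem_nhds y₀ one_pos)
      (Eventually.of_forall fun y => (integrable_smul_iteratedFDeriv_tilt hk hK m y).aestronglyMeasurable)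
      (integrable_smul_iteratedFDeriv_tilt hk hK m y₀) hF'm
      (Eventually.of_forall h_bound) hbi (Eventually.of_forall fun x y _ => h_diff x y)
    -- identify the derivative: the integral commutes with currying
    have e : ∫ x, (k x • iteratedFDeriv ℝ (m + 1)
        (fun y : E => Real.exp (⟪x, y⟫ - ‖y‖ ^ 2 / 2)) y₀).curryLeft ∂stdGaussian E =
        (∫ x, k x • iteratedFDeriv ℝ (m + 1)
          (fun y : E => Real.exp (⟪x, y⟫ - ‖y‖ ^ 2 / 2)) y₀ ∂stdGaussian E).curryLeft := by
      show ∫ x, Lc (k x • iteratedFDeriv ℝ (m + 1)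
        (fun y : E => Real.exp (⟪x, y⟫ - ‖y‖ ^ 2 / 2)) y₀) ∂stdGaussian E = Lc _
      exact ContinuousLinearEquiv.integral_comp_comm (𝕜 := ℝ) (X := E) (μ := stdGaussian E)
        (E := ContinuousMultilinearMap ℝ (fun _ : Fin (m + 1) => E) ℝ)
        (F := E →L[ℝ] ContinuousMultilinearMap ℝ (fun _ : Fin m => E) ℝ)
        Lc.toContinuousLinearEquiv (fun x => k x • iteratedFDeriv ℝ (m + 1)
          (fun y : E => Real.exp (⟪x, y⟫ - ‖y‖ ^ 2 / 2)) y₀)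
    rw [e] at hmain
    exact hmain

/-- **Gaussian averages of bounded measurable functions are smooth**: `y ↦ E_γ[k(y + ·)]` is `C^∞`
(Janson 1997, Theorem 14.1 (vi): the Cameron–Martin shift `ρ_ξ` maps `L^∞` into smooth functions of
`ξ`). [cite: Janson1997, Theorem 14.1] -/
theorem contDiff_integral_stdGaussian_comp_add (hk : Measurable k) (hK : ∀ z, |k z| ≤ K) :
    ContDiff ℝ ∞ fun y : E => ∫ x, k (y + x) ∂stdGaussian E :=
  (hasFTaylorSeriesUpTo_integral_stdGaussian_comp_add hk hK).contDiff

/-- **Uniform derivative bounds**: `‖Dⁿ_y E_γ[k(y + ·)]‖ ≤ ‖k‖_∞ · n! · E_γ[(‖x‖+1)ⁿ]` for every `y`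
(the bound at `y = 0` transported by translation invariance). [cite: Janson1997, Theorem 14.1] -/
theorem norm_iteratedFDeriv_integral_stdGaussian_comp_add_le (hk : Measurable k) (hK : ∀ z, |k z| ≤ K)
    (n : ℕ) (y : E) :
    ‖iteratedFDeriv ℝ n (fun y : E => ∫ x, k (y + x) ∂stdGaussian E) y‖ ≤
      K * n.factorial * ∫ x, (‖x‖ + 1) ^ n ∂stdGaussian E := by
  have hK0 : 0 ≤ K := (abs_nonneg _).trans (hK 0)
  -- translate: the `n`-th derivative at `y` is that of the average of `k(y + ·)` at `0`
  set ky : E → ℝ := fun z => k (y + z) with hky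
  have hkym : Measurable ky := hk.comp (measurable_const_add y)
  have hkyK : ∀ z, |ky z| ≤ K := fun z => hK _
  have htr : iteratedFDeriv ℝ n (fun y : E => ∫ x, k (y + x) ∂stdGaussian E) y =
      iteratedFDeriv ℝ n (fun u : E => ∫ x, ky (u + x) ∂stdGaussian E) 0 := by
    have hfun : (fun u : E => ∫ x, ky (u + x) ∂stdGaussian E) =
        fun u => (fun y : E => ∫ x, k (y + x) ∂stdGaussian E) (y + u) := by
      funext u
      simp only [hky, add_assoc]
    rw [hfun, iteratedFDeriv_comp_add_left' (𝕜 := ℝ)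
      (f := fun y : E => ∫ x, k (y + x) ∂stdGaussian E) n y]
    simp only [add_zero]
  have hn : (n : ℕ∞ω) ≤ ∞ := by exact_mod_cast le_top
  rw [htr, ← (hasFTaylorSeriesUpTo_integral_stdGaussian_comp_add hkym hkyK).eq_iteratedFDeriv hn 0]
  -- bound the Taylor coefficient at `0`
  have hint := integrable_norm_add_one_pow (E := E) n
  calc ‖∫ x, ky x • iteratedFDeriv ℝ n (fun y : E => Real.exp (⟪x, y⟫ - ‖y‖ ^ 2 / 2)) 0
        ∂stdGaussian E‖
      ≤ ∫ x, K * n.factorial * (‖x‖ + 1) ^ n ∂stdGaussian E := by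
        refine norm_integral_le_of_norm_le (hint.const_mul _) (Eventually.of_forall fun x => ?_)
        rw [norm_smul, Real.norm_eq_abs]
        calc |ky x| * ‖iteratedFDeriv ℝ n (fun y : E => Real.exp (⟪x, y⟫ - ‖y‖ ^ 2 / 2)) 0‖
            ≤ K * ((n.factorial : ℝ) * (‖x‖ + 1) ^ n) :=
              mul_le_mul (hkyK x) (norm_iteratedFDeriv_tilt_zero_le x n) (norm_nonneg _) hK0
          _ = K * n.factorial * (‖x‖ + 1) ^ n := by ring
    _ = K * n.factorial * ∫ x, (‖x‖ + 1) ^ n ∂stdGaussian E := integral_const_mul _ _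

end Smoothing

/-! ### 4. Nondegenerate covariance: `φ ↦ E_S[k(φ + ζ)]` for `S ≻ 0` -/

section Covariance

variable {ι : Type*} [Fintype ι] [DecidableEq ι]

/-- `‖√S z‖² = ⟨z, S z⟩` for positive semidefinite `S`. [folklore] -/
private theorem norm_sqrt_apply_sq'' {S : Matrix ι ι ℝ} (hS : S.PosSemidef) (z : EuclideanSpace ℝ ι) :
    ‖Matrix.toEuclideanCLM (𝕜 := ℝ) (CFC.sqrt S) z‖ ^ 2 = ⟪z, Matrix.toEuclideanLin S z⟫ := by
  set T := Matrix.toEuclideanCLM (𝕜 := ℝ) (CFC.sqrt S) with hT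
  have hsa : IsSelfAdjoint T := (CFC.sqrt_nonneg S).isSelfAdjoint.map _
  rw [← real_inner_self_eq_norm_sq, ← ContinuousLinearMap.adjoint_inner_right, hsa.adjoint_eq,
    ← ContinuousLinearMap.comp_apply, ← ContinuousLinearMap.mul_def, hT, ← map_mul,
    CFC.sqrt_mul_sqrt_self _ hS.nonneg]
  rfl

/-- For `S ≻ 0` the square root `√S` is a linear homeomorphism of `ℝ^ι`. [folklore] -/
private theorem exists_equiv_sqrt {S : Matrix ι ι ℝ} (hS : S.PosDef) :
    ∃ e : EuclideanSpace ℝ ι ≃L[ℝ] EuclideanSpace ℝ ι,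
      (e : EuclideanSpace ℝ ι →L[ℝ] EuclideanSpace ℝ ι) =
        Matrix.toEuclideanCLM (𝕜 := ℝ) (CFC.sqrt S) := by
  obtain ⟨c, hc, hSc⟩ := exists_pos_mul_norm_sq_le_inner_of_posDef hS
  set T := Matrix.toEuclideanCLM (𝕜 := ℝ) (CFC.sqrt S) with hT
  have hTsq : ∀ z, c * ‖z‖ ^ 2 ≤ ‖T z‖ ^ 2 := fun z => by
    rw [hT, norm_sqrt_apply_sq'' hS.posSemidef]; exact hSc z
  have hinj : Function.Injective T := by
    intro x y hxy
    have h0 : T (x - y) = 0 := by rw [map_sub, hxy, sub_self]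
    have h1 := hTsq (x - y)
    rw [h0, norm_zero] at h1
    have h1' : c * ‖x - y‖ ^ 2 ≤ 0 := by simpa using h1
    have h2 : ‖x - y‖ ^ 2 ≤ 0 := by
      by_contra hne
      exact absurd h1' (not_le.2 (mul_pos hc (not_le.1 hne)))
    have h3 : ‖x - y‖ = 0 := by nlinarith [norm_nonneg (x - y)]
    exact sub_eq_zero.1 (norm_eq_zero.1 h3)
  have hsurj : Function.Surjective T :=
    LinearMap.surjective_of_injective (f := (T : EuclideanSpace ℝ ι →ₗ[ℝ] EuclideanSpace ℝ ι)) hinj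
  let eₗ : EuclideanSpace ℝ ι ≃ₗ[ℝ] EuclideanSpace ℝ ι :=
    LinearEquiv.ofBijective (T : EuclideanSpace ℝ ι →ₗ[ℝ] EuclideanSpace ℝ ι) ⟨hinj, hsurj⟩
  refine ⟨eₗ.toContinuousLinearEquiv, ?_⟩
  ext v
  rfl

/-- **Gaussian averages for a nondegenerate covariance.**  For `S ≻ 0` and a bounded measurable
`k`, `φ ↦ E_S[k(φ + ζ)]` is `C^∞` and each derivative is bounded uniformly in `φ` (the standard case
transported by `√S`: `E_S[k(φ + ζ)] = E_γ[(k ∘ √S)(√S⁻¹φ + x)]`). [cite: Janson1997, Theorem 14.1] -/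
theorem contDiff_integral_multivariateGaussian_comp_add {S : Matrix ι ι ℝ} (hS : S.PosDef)
    {k : EuclideanSpace ℝ ι → ℝ} (hk : Measurable k) {K : ℝ} (hK : ∀ z, |k z| ≤ K) :
    ContDiff ℝ ∞ (fun φ => ∫ ζ, k (φ + ζ) ∂multivariateGaussian 0 S) ∧
      ∀ n : ℕ, ∃ B : ℝ, ∀ φ,
        ‖iteratedFDeriv ℝ n (fun φ => ∫ ζ, k (φ + ζ) ∂multivariateGaussian 0 S) φ‖ ≤ B := by
  obtain ⟨e, he⟩ := exists_equiv_sqrt hS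
  set T := Matrix.toEuclideanCLM (𝕜 := ℝ) (CFC.sqrt S) with hT
  -- the transported integrand
  set kT : EuclideanSpace ℝ ι → ℝ := fun x => k (T x) with hkT
  have hkTm : Measurable kT := hk.comp T.continuous.measurable
  have hkTK : ∀ z, |kT z| ≤ K := fun z => hK _
  set G : EuclideanSpace ℝ ι → ℝ := fun y => ∫ x, kT (y + x) ∂stdGaussian (EuclideanSpace ℝ ι) with hG
  have hmeas : AEMeasurable (fun x : EuclideanSpace ℝ ι => (0 : EuclideanSpace ℝ ι) + T x)
      (stdGaussian (EuclideanSpace ℝ ι)) := by fun_prop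
  -- `E_S[k(φ + ζ)] = G(e⁻¹ φ)`
  have hrepr : (fun φ => ∫ ζ, k (φ + ζ) ∂multivariateGaussian 0 S) =
      G ∘ (e.symm : EuclideanSpace ℝ ι →L[ℝ] EuclideanSpace ℝ ι) := by
    funext φ
    have hmφ : Measurable fun ζ => k (φ + ζ) := hk.comp (measurable_const_add φ)
    simp only [Function.comp, hG, hkT]
    rw [multivariateGaussian, ← hT, integral_map hmeas hmφ.aestronglyMeasurable]
    refine integral_congr_ae (Eventually.of_forall fun x => ?_)
    simp only [zero_add]
    congr 1
    have h1 : T (e.symm φ) = φ := by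
      have := e.apply_symm_apply φ
      rwa [← ContinuousLinearEquiv.coe_coe, he] at this
    rw [map_add]
    simp only [ContinuousLinearEquiv.coe_coe]
    rw [h1]
  have hGs : ContDiff ℝ ∞ G := contDiff_integral_stdGaussian_comp_add hkTm hkTK
  refine ⟨?_, fun n => ?_⟩
  · rw [hrepr]
    exact hGs.comp (e.symm : EuclideanSpace ℝ ι →L[ℝ] EuclideanSpace ℝ ι).contDiff
  · refine ⟨K * n.factorial * (∫ x, (‖x‖ + 1) ^ n ∂stdGaussian (EuclideanSpace ℝ ι)) *
      ‖(e.symm : EuclideanSpace ℝ ι →L[ℝ] EuclideanSpace ℝ ι)‖ ^ n, fun φ => ?_⟩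
    have hn : (n : ℕ∞ω) ≤ ∞ := by exact_mod_cast le_top
    rw [hrepr, ContinuousLinearMap.iteratedFDeriv_comp_right _ hGs φ hn]
    refine (ContinuousMultilinearMap.norm_compContinuousLinearMap_le _ _).trans ?_
    rw [Finset.prod_const, Finset.card_univ, Fintype.card_fin]
    exact mul_le_mul_of_nonneg_right
      (norm_iteratedFDeriv_integral_stdGaussian_comp_add_le hkTm hkTK n _) (by positivity)

end Covariance

/-! ### 5. The renormalised potential `V_s` is `C_b^∞` for bounded measurable `V₀` and `C_s ≻ 0` -/

section RenormPotential

variable {N : ℕ} (D : CovDecomposition N) {V₀ : EuclideanSpace ℝ (Fin N) → ℝ}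

/-- **Regularity of the renormalised potential** ([BBD] Def 2): for `V₀` measurable with `|V₀| ≤ B`
and `C_s ≻ 0`, `V_s = −log E_{C_s}[e^{−V₀(·+ζ)}]` is `C^∞` (Gaussian smoothing of the bounded function
`e^{−V₀}`, and `log` on `[e^{−B}, e^{B}]`). [cite: BauerschmidtBodineauDagallier2023, Definition 2] -/
theorem contDiff_renormPotential_of_posDef (hV : Measurable V₀) {BV : ℝ} (hVB : ∀ x, |V₀ x| ≤ BV)
    {s : ℝ} (hS : (D.C s).PosDef) : ContDiff ℝ ∞ (renormPotential D V₀ s) := by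
  have hb : ∀ φ, -BV ≤ V₀ φ := fun φ => (abs_le.1 (hVB φ)).1
  have hkm : Measurable fun x => Real.exp (-V₀ x) := hV.neg.exp
  have hkK : ∀ z, |Real.exp (-V₀ z)| ≤ Real.exp BV := fun z => by
    rw [abs_of_pos (Real.exp_pos _), Real.exp_le_exp]
    exact (neg_le_abs _).trans (hVB z)
  have hZ := (contDiff_integral_multivariateGaussian_comp_add hS hkm hkK).1
  have hpos : ∀ φ, (∫ ζ, Real.exp (-V₀ (φ + ζ)) ∂multivariateGaussian 0 (D.C s)) ≠ 0 :=
    fun φ => (integral_exp_neg_pos hV hb _ φ).ne'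
  have h := (hZ.log hpos).neg
  exact h

/-- **Uniform bounds on all derivatives of `V_s`** up to any order `n₀` ([BBD] Def 2; the class
`C_b^{n₀}` needed by the tree's proof of Theorem 3): for `V₀` measurable with `|V₀| ≤ B` and
`C_s ≻ 0`, `∃ B', ∀ n ≤ n₀, ∀ φ, ‖Dⁿ V_s(φ)‖ ≤ B'`. [cite: BauerschmidtBodineauDagallier2023, Definition 2] -/
theorem exists_bound_iteratedFDeriv_renormPotential_of_posDef (hV : Measurable V₀) {BV : ℝ}
    (hVB : ∀ x, |V₀ x| ≤ BV) {s : ℝ} (hS : (D.C s).PosDef) (n₀ : ℕ) :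
    ∃ B : ℝ, ∀ n ≤ n₀, ∀ φ, ‖iteratedFDeriv ℝ n (renormPotential D V₀ s) φ‖ ≤ B := by
  have hb : ∀ φ, -BV ≤ V₀ φ := fun φ => (abs_le.1 (hVB φ)).1
  have hkm : Measurable fun x => Real.exp (-V₀ x) := hV.neg.exp
  have hkK : ∀ z, |Real.exp (-V₀ z)| ≤ Real.exp BV := fun z => by
    rw [abs_of_pos (Real.exp_pos _), Real.exp_le_exp]
    exact (neg_le_abs _).trans (hVB z)
  obtain ⟨hZ, hZb⟩ := contDiff_integral_multivariateGaussian_comp_add hS hkm hkK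
  set Z : EuclideanSpace ℝ (Fin N) → ℝ :=
    fun φ => ∫ ζ, Real.exp (-V₀ (φ + ζ)) ∂multivariateGaussian 0 (D.C s) with hZdef
  -- the range of `Z` lies in the compact interval `[e^{−B}, e^{B}] ⊆ (0, ∞)`
  have hZlo : ∀ φ, Real.exp (-BV) ≤ Z φ := fun φ => by
    have hVB' : ∀ x, |(-V₀) x| ≤ BV := fun x => by simpa using hVB x
    calc Real.exp (-BV) = ∫ _ζ, Real.exp (-BV) ∂multivariateGaussian 0 (D.C s) := by simp
      _ ≤ Z φ := integral_mono (integrable_const _)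
          (Integrable.of_bound ((hkm.comp (measurable_const_add φ)).aestronglyMeasurable)
            (Real.exp BV) (Eventually.of_forall fun ζ => by
              rw [Real.norm_eq_abs]; exact hkK _))
          fun ζ => Real.exp_le_exp.2 (by linarith [(abs_le.1 (hVB (φ + ζ))).2])
  have hZhi : ∀ φ, Z φ ≤ Real.exp BV := fun φ => by
    have h := integral_exp_neg_le hV hb (multivariateGaussian 0 (D.C s)) φ
    simpa using h
  have hZpos : ∀ φ, 0 < Z φ := fun φ => (Real.exp_pos _).trans_le (hZlo φ)
  -- bounds for the derivatives of `log` on the interval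
  set t : Set ℝ := Ioi 0 with ht
  have htu : UniqueDiffOn ℝ t := uniqueDiffOn_Ioi 0
  have hlog : ContDiffOn ℝ ∞ Real.log t :=
    Real.contDiffOn_log.mono fun x hx => ne_of_gt (mem_Ioi.1 hx)
  have hC : ∀ i : ℕ, ∃ C : ℝ, ∀ u ∈ Icc (Real.exp (-BV)) (Real.exp BV),
      ‖iteratedFDerivWithin ℝ i Real.log t u‖ ≤ C := by
    intro i
    have hi : (i : ℕ∞ω) ≤ ∞ := by exact_mod_cast le_top
    have hcont : ContinuousOn (iteratedFDerivWithin ℝ i Real.log t) t :=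
      hlog.continuousOn_iteratedFDerivWithin hi htu
    have hsub : Icc (Real.exp (-BV)) (Real.exp BV) ⊆ t := fun u hu =>
      mem_Ioi.2 ((Real.exp_pos _).trans_le hu.1)
    obtain ⟨C, hC⟩ := isCompact_Icc.exists_bound_of_continuousOn (hcont.mono hsub)
    exact ⟨C, hC⟩
  choose Cf hCf using hC
  set C : ℝ := ∑ i ∈ Finset.range (n₀ + 1), |Cf i| with hCdef
  have hCi : ∀ i ≤ n₀, ∀ u ∈ Icc (Real.exp (-BV)) (Real.exp BV),
      ‖iteratedFDerivWithin ℝ i Real.log t u‖ ≤ C := fun i hi u hu =>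
    (hCf i u hu).trans ((le_abs_self _).trans (Finset.single_le_sum (f := fun i => |Cf i|)
      (fun _ _ => abs_nonneg _) (Finset.mem_range.2 (Nat.lt_succ_of_le hi))))
  -- bounds for the derivatives of `Z`
  choose Bf hBf using hZb
  set Dz : ℝ := 1 + ∑ i ∈ Finset.range (n₀ + 1), |Bf i| with hDz
  have hDz1 : 1 ≤ Dz := by
    have : 0 ≤ ∑ i ∈ Finset.range (n₀ + 1), |Bf i| := Finset.sum_nonneg fun _ _ => abs_nonneg _
    linarith
  have hDi : ∀ i, 1 ≤ i → i ≤ n₀ → ∀ φ, ‖iteratedFDeriv ℝ i Z φ‖ ≤ Dz ^ i := by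
    intro i _ hi φ
    have h1 : ‖iteratedFDeriv ℝ i Z φ‖ ≤ Dz := by
      refine (hBf i φ).trans ((le_abs_self _).trans ?_)
      have := Finset.single_le_sum (f := fun i => |Bf i|) (fun _ _ => abs_nonneg _)
        (Finset.mem_range.2 (Nat.lt_succ_of_le hi))
      rw [hDz]
      linarith
    exact h1.trans (le_self_pow₀ hDz1 (by omega))
  -- assemble with the Faà di Bruno bound
  refine ⟨(n₀.factorial : ℝ) * C * Dz ^ n₀ + |C|, fun n hn φ => ?_⟩
  have hn' : (n : ℕ∞ω) ≤ ∞ := by exact_mod_cast le_top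
  have hVeq : renormPotential D V₀ s = -(Real.log ∘ Z) := by
    funext φ
    unfold renormPotential
    rfl
  rw [hVeq, iteratedFDeriv_neg_apply, norm_neg]
  have hrange : Set.range Z ⊆ t := by
    rintro _ ⟨φ, rfl⟩; exact mem_Ioi.2 (hZpos φ)
  have hmain := norm_iteratedFDeriv_comp_le' (n := n) hrange htu hlog hZ hn' φ
    (fun i hi => hCi i (hi.trans hn) (Z φ) ⟨hZlo φ, hZhi φ⟩)
    (fun i hi1 hi2 => hDi i hi1 (hi2.trans hn) φ)
  refine hmain.trans ?_
  have hC0 : 0 ≤ C := Finset.sum_nonneg fun _ _ => abs_nonneg _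
  have h1 : (n.factorial : ℝ) * C * Dz ^ n ≤ (n₀.factorial : ℝ) * C * Dz ^ n₀ := by
    have hf : (n.factorial : ℝ) ≤ n₀.factorial := by exact_mod_cast Nat.factorial_le hn
    have hp : Dz ^ n ≤ Dz ^ n₀ := pow_le_pow_right₀ hDz1 hn
    calc (n.factorial : ℝ) * C * Dz ^ n ≤ (n₀.factorial : ℝ) * C * Dz ^ n :=
          mul_le_mul_of_nonneg_right (mul_le_mul_of_nonneg_right hf hC0) (by positivity)
      _ ≤ (n₀.factorial : ℝ) * C * Dz ^ n₀ := mul_le_mul_of_nonneg_left hp (by positivity)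
  linarith [abs_nonneg C]

end RenormPotential

end Polchinski

end Literature.Analysis.FunctionSpaces

end
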